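import Literature.NumberTheory.Sieve.SmoothNumbersAPSegment
import Literature.NumberTheory.Sieve.SmoothCanonicalPrefix
import Literature.NumberTheory.Sieve.SmoothMinorArcsResidues
import Literature.NumberTheory.Sieve.PrimePowersInProgressions
import HarnessLib

/-!
# Large values of exponential sums over smooth numbers, V: fairly major differences, the hard range

Topic `Literature/NumberTheory/Sieve`; a PROVED file toward
`Literature.NumberTheory.DiophantineGeometry.XYZUpperHalf` ([Harper2016, Cor. 1]). This is the
first ("harder") half of the proof of Proposition 4 of op. cit. (§4, p. 17): for `t = a/q + η`,
`(a, q) = 1`, `η > 0`, and `m` in the range `m η q > 1/2` (Harper's `m > M̃ = 1/(2q|η|)`), the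
range of `m` is cut into the cells `j/(qKη) < m ≤ (j+1)/(qKη)`; writing `j = K f(j) + k(j)` with
`|k(j)| ≤ K/2` one has `|m t − (ma + f(j))/q − k(j)/(qK)| ≤ 1/(qK)`, so that `‖mt‖ ≍ ‖c/q‖` on the
classes `ma + f(j) ≡ c ≢ 0 (mod q)`, `‖mt‖ ≍ |k(j)|/(qK)` on the class `c = 0` when `|k(j)| ≥ 2`,
and only the cells with `c = 0`, `k(j) ∈ {−1, 0, 1}` are bounded trivially by `x/m`. Counting each
cell and class by Smooth Numbers Result 3 (`card_smooth_segment_modEq_le`) gives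

`sum_geomBound_prefix_hard_le`: with `W = x/(yK)`, `𝓜 = prefixSet y W`, `𝓟 = x^α ζ(α,y)/√φ₂(α,y)`,
`P₀ = q²Kηx`,
`∑_{m ∈ 𝓜, mηq > 1/2} min(x/m, 1/(2‖mt‖)) ≤ C log y (1 + log q + log K + log(P₀ + 1)) y^{1−α} P₀^{1−α} 𝓟 / K`

(printed: `≪ (Ψ(x,y)/K) log³x (q²Kηx)^{1−α}`, loc. cit.).

## References

* A. J. Harper, *Minor arcs, mean values, and restriction theory for exponential sums over smooth
  numbers*, Compositio Math. 152 (2016) 1121–1158, §4, Proposition 4 (p. 17) [Harper2016].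
-/

noncomputable section

open Finset Real
open Literature.NumberTheory.Sieve.Vinogradov

namespace Literature.NumberTheory.Sieve

/-! ### Small tools -/

/-- If `0 < ‖s‖` and `|ε| ≤ (3/4)‖s‖` then `min(V, 1/(2‖s+ε‖)) ≤ 2/‖s‖`.
[cite: Harper2016, §4, proof of Proposition 4 (p. 17)] -/
theorem geomBound_le_two_div {s ε : ℝ} (V : ℝ) (hs : 0 < distInt s)
    (hε : |ε| ≤ 3 / 4 * distInt s) : geomBound V (s + ε) ≤ 2 / distInt s := by
  have h1 : distInt s / 4 ≤ distInt (s + ε) := by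
    have h2 : distInt s - distInt (s + ε - s) ≤ distInt (s + ε) := distInt_sub_distInt_le (s + ε) s
    rw [show s + ε - s = ε by ring] at h2
    have h3 : distInt ε ≤ |ε| := by
      have := distInt_le_abs_sub_int ε 0; simpa using this
    linarith
  have hpos : 0 < distInt (s + ε) := lt_of_lt_of_le (by linarith) h1
  calc geomBound V (s + ε) ≤ 1 / (2 * distInt (s + ε)) := geomBound_le_inv V hpos
    _ ≤ 1 / (2 * (distInt s / 4)) := by
        apply one_div_le_one_div_of_le (by linarith); linarith
    _ = 2 / distInt s := by field_simp; ring

/-- `min(|z|, 1 − |z|) ≤ ‖z‖`. [folklore] -/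
theorem min_abs_le_distInt (z : ℝ) : min |z| (1 - |z|) ≤ distInt z := by
  unfold distInt
  set n := round z with hn
  rcases eq_or_ne n 0 with h0 | h0
  · simp [h0]
  · have h1 : (1 : ℝ) ≤ |(n : ℝ)| := by exact_mod_cast Int.one_le_abs h0
    have h2 : |(n : ℝ)| - |z| ≤ |z - n| := by
      have := abs_sub_abs_le_abs_sub (n : ℝ) z
      rw [abs_sub_comm] at this; linarith
    have : 1 - |z| ≤ |z - n| := by linarith
    exact le_trans (min_le_right _ _) this

/-- The centred residue: `j = K f + k` with `2|k| ≤ K` and `0 ≤ f`; moreover if `|k| ≤ 1` then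
`f = (j + 1)/K` (integer division). [folklore] -/
theorem exists_centred_residue {K : ℕ} (hK : 3 ≤ K) (j : ℕ) :
    ∃ (f : ℕ) (k : ℤ), (j : ℤ) = K * f + k ∧ 2 * |k| ≤ K ∧ (|k| ≤ 1 → f = (j + 1) / K) := by
  have hK0 : 0 < K := by omega
  set r := j % K with hr
  have hrK : r < K := Nat.mod_lt _ hK0
  have hj : j = K * (j / K) + r := (Nat.div_add_mod j K).symm
  by_cases h2 : 2 * r ≤ K
  · refine ⟨j / K, (r : ℤ), by exact_mod_cast hj, ?_, ?_⟩
    · rw [Nat.abs_cast]; exact_mod_cast h2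
    · intro hk
      rw [Nat.abs_cast] at hk
      have hr1 : r ≤ 1 := by exact_mod_cast hk
      -- `j + 1 = K (j/K) + (r + 1)`, `r + 1 < K`
      have : (j + 1) / K = j / K := by
        rw [hj]
        rw [show K * (j / K) + r + 1 = (r + 1) + K * (j / K) by ring, Nat.add_mul_div_left _ _ hK0,
          Nat.div_eq_of_lt (by omega : r + 1 < K), show K * (j / K) + r = r + K * (j / K) by ring,
          Nat.add_mul_div_left _ _ hK0, Nat.div_eq_of_lt hrK]
      rw [this]
  · push Not at h2
    have hjz : (j : ℤ) = (K : ℤ) * ((j / K : ℕ) : ℤ) + r := by exact_mod_cast hj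
    refine ⟨j / K + 1, (r : ℤ) - K, ?_, ?_, ?_⟩
    · rw [hjz, Nat.cast_add, Nat.cast_one]; ring
    · have : (r : ℤ) - K ≤ 0 := by have := hrK.le; linarith [(by exact_mod_cast hrK.le : (r : ℤ) ≤ K)]
      rw [abs_of_nonpos this]
      have : (2 : ℤ) * r > K := by exact_mod_cast h2
      linarith
    · intro hk
      have hneg : (r : ℤ) - K ≤ 0 := by linarith [(by exact_mod_cast hrK.le : (r : ℤ) ≤ K)]
      rw [abs_of_nonpos hneg] at hk
      have hr1 : K ≤ r + 1 := by
        have : (K : ℤ) - r ≤ 1 := by linarith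
        omega
      have hrK1 : r + 1 = K := by omega
      nth_rw 2 [hj]
      rw [show K * (j / K) + r + 1 = K * (j / K + 1) by rw [mul_add, mul_one, add_assoc, hrK1],
        Nat.mul_div_cancel_left _ hK0]

/-- `∑_{c=1}^{q-1} 2/‖c/q‖ ≤ 4 q (1 + log q)`. [cite: Harper2016, §4, p. 17 (`∑_b q/b`)] -/
theorem sum_two_div_distInt_le {q : ℕ} (hq : 0 < q) :
    ∑ c ∈ (Finset.range q).filter (fun c => c ≠ 0), 2 / distInt ((c : ℝ) / q) ≤
      4 * q * (1 + Real.log q) := by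
  classical
  have hqr : (0 : ℝ) < q := by exact_mod_cast hq
  set Rset := (Finset.range q).filter (fun c => c ≠ 0) with hRset
  -- `‖n/q‖ ≥ 1/q` for `q ∤ n`
  have hfar : ∀ n : ℤ, ¬ (q : ℤ) ∣ n → 1 / (q : ℝ) ≤ distInt ((n : ℝ) / q) := by
    intro n hn
    unfold distInt
    set k := round ((n : ℝ) / q) with hk
    have hne : n - k * q ≠ 0 := fun h => hn ⟨k, by linarith⟩
    have h1 : (1 : ℝ) ≤ |(((n - k * q : ℤ)) : ℝ)| := by exact_mod_cast Int.one_le_abs hne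
    have heq : (n : ℝ) / q - k = (((n - k * q : ℤ)) : ℝ) / q := by push_cast; field_simp
    rw [heq, abs_div, abs_of_pos hqr]
    exact div_le_div_of_nonneg_right h1 hqr.le
  have hsp : ∑ c ∈ Rset, 1 / (2 * distInt ((c : ℝ) / q)) ≤ (1 / (1 / (q : ℝ))) * (1 + Real.log q) := by
    apply sum_inv_distInt_le_of_separated Rset (fun c : ℕ => (c : ℝ) / q) (δ := 1 / q)
      (by positivity) (m := q)
    · rw [show (1 : ℝ) / (2 * (1 / q)) = q / 2 by field_simp]; linarith
    · intro i hi j hj hij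
      rw [hRset, Finset.mem_filter, Finset.mem_range] at hi hj
      have hnd : ¬ (q : ℤ) ∣ ((i : ℤ) - j) := by
        intro h
        have hlt : |(i : ℤ) - j| < q := by rw [abs_lt]; constructor <;> omega
        have := Int.eq_zero_of_abs_lt_dvd h hlt
        omega
      have := hfar ((i : ℤ) - j) hnd
      push_cast at this
      rw [show (i : ℝ) / q - (j : ℝ) / q = ((i : ℝ) - j) / q by ring]
      exact this
    · intro i hi
      rw [hRset, Finset.mem_filter, Finset.mem_range] at hi
      have hnd : ¬ (q : ℤ) ∣ (i : ℤ) := by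
        intro h
        have h1 : (q : ℤ) ≤ i := Int.le_of_dvd (by exact_mod_cast Nat.pos_of_ne_zero hi.2) h
        have : q ≤ i := by exact_mod_cast h1
        omega
      have := hfar i hnd; push_cast at this; exact this
  rw [one_div_one_div] at hsp
  calc ∑ c ∈ Rset, 2 / distInt ((c : ℝ) / q) = 4 * ∑ c ∈ Rset, 1 / (2 * distInt ((c : ℝ) / q)) := by
        rw [Finset.mul_sum]
        refine Finset.sum_congr rfl fun c _ => ?_
        rcases eq_or_ne (distInt ((c : ℝ) / q)) 0 with h0 | h0
        · rw [h0]; simp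
        · field_simp; ring
    _ ≤ 4 * ((q : ℝ) * (1 + Real.log q)) := by gcongr
    _ = 4 * q * (1 + Real.log q) := by ring

/-! ### Pointwise bounds in one cell -/

section Cell

variable {x η : ℝ} {q K : ℕ} {a : ℤ} {m j f : ℕ} {k : ℤ}

/-- The decomposition `m t = (ma + f)/q + ε`, `|ε| ≤ 3/(4q)`, `(|k| − 1)/(qK) ≤ |ε| ≤ (|k|+1)/(qK)`
in the cell `j ≤ m q K η < j + 1`, `j = K f + k`. [cite: Harper2016, §4, p. 17] -/
theorem cell_decomposition (hq : 0 < q) (hK : 4 ≤ K)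
    (hjlo : (j : ℝ) ≤ (m : ℝ) * q * K * η) (hjhi : (m : ℝ) * q * K * η < j + 1)
    (hfk : (j : ℤ) = K * f + k) (h2k : 2 * |k| ≤ K) :
    ∃ ε : ℝ, (m : ℝ) * ((a : ℝ) / q + η) = (((m : ℤ) * a + f : ℤ) : ℝ) / q + ε ∧
      |ε| ≤ 3 / (4 * (q : ℝ)) ∧ ((|k| : ℝ) - 1) / (q * K) ≤ |ε| ∧ |ε| ≤ ((|k| : ℝ) + 1) / (q * K) := by
  have hqr : (0 : ℝ) < q := by exact_mod_cast hq
  have hKr : (4 : ℝ) ≤ K := by exact_mod_cast hK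
  have hK0 : (0 : ℝ) < K := by linarith
  have hqK : (0 : ℝ) < q * K := by positivity
  set φ : ℝ := (m : ℝ) * η - (j : ℝ) / (q * K) with hφ
  have hφ0 : 0 ≤ φ := by
    rw [hφ, sub_nonneg, div_le_iff₀ hqK]; linarith
  have hφ1 : φ < 1 / (q * K) := by
    rw [hφ, sub_lt_iff_lt_add, ← add_div, lt_div_iff₀ hqK]; linarith
  have hjr : (j : ℝ) = K * f + k := by exact_mod_cast hfk
  refine ⟨(k : ℝ) / (q * K) + φ, ?_, ?_, ?_, ?_⟩
  · push_cast
    rw [hφ, hjr]; field_simp; ring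
  · have h1 : |(k : ℝ) / (q * K) + φ| ≤ |(k : ℝ)| / (q * K) + φ := by
      calc |(k : ℝ) / (q * K) + φ| ≤ |(k : ℝ) / (q * K)| + |φ| := abs_add_le _ _
        _ = |(k : ℝ)| / (q * K) + φ := by rw [abs_div, abs_of_pos hqK, abs_of_nonneg hφ0]
    have h2k' : 2 * |(k : ℝ)| ≤ K := by
      have : ((2 * |k| : ℤ) : ℝ) ≤ ((K : ℤ) : ℝ) := by exact_mod_cast h2k
      push_cast at this; exact this
    have h2 : |(k : ℝ)| / (q * K) ≤ 1 / (2 * q) := by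
      rw [div_le_div_iff₀ hqK (by positivity)]; nlinarith
    have h3 : φ ≤ 1 / (4 * q) := by
      have : 1 / ((q : ℝ) * K) ≤ 1 / (4 * q) := by
        apply one_div_le_one_div_of_le (by positivity); nlinarith
      linarith
    calc |(k : ℝ) / (q * K) + φ| ≤ |(k : ℝ)| / (q * K) + φ := h1
      _ ≤ 1 / (2 * q) + 1 / (4 * q) := add_le_add h2 h3
      _ = 3 / (4 * (q : ℝ)) := by field_simp; norm_num
  · -- lower bound `|ε| ≥ |k|/(qK) − φ ≥ (|k| − 1)/(qK)`
    have h1 : |(k : ℝ)| / (q * K) - φ ≤ |(k : ℝ) / (q * K) + φ| := by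
      have := abs_sub_abs_le_abs_sub ((k : ℝ) / (q * K)) (-φ)
      rw [abs_neg, abs_of_nonneg hφ0, sub_neg_eq_add, abs_div, abs_of_pos hqK] at this
      exact this
    have h2 : ((|k| : ℝ) - 1) / (q * K) ≤ |(k : ℝ)| / (q * K) - φ := by
      rw [sub_div]
      linarith [hφ1.le]
    exact h2.trans h1
  · calc |(k : ℝ) / (q * K) + φ| ≤ |(k : ℝ) / (q * K)| + |φ| := abs_add_le _ _
      _ = |(k : ℝ)| / (q * K) + φ := by rw [abs_div, abs_of_pos hqK, abs_of_nonneg hφ0]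
      _ ≤ |(k : ℝ)| / (q * K) + 1 / (q * K) := by linarith [hφ1.le]
      _ = ((|k| : ℝ) + 1) / (q * K) := by ring

/-- **Nonzero classes**: if `ma + f ≢ 0 (mod q)` then `min(x/m, 1/(2‖mt‖)) ≤ 2/‖c/q‖`,
`c = (ma + f) mod q`. [cite: Harper2016, §4, p. 17] -/
theorem geomBound_cell_le_of_ne (hq : 0 < q) (hK : 4 ≤ K)
    (hjlo : (j : ℝ) ≤ (m : ℝ) * q * K * η) (hjhi : (m : ℝ) * q * K * η < j + 1)
    (hfk : (j : ℤ) = K * f + k) (h2k : 2 * |k| ≤ K) (hc : ((m : ℤ) * a + f) % q ≠ 0) (V : ℝ) :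
    geomBound V ((m : ℝ) * ((a : ℝ) / q + η)) ≤
      2 / distInt ((((((m : ℤ) * a + f) % q : ℤ)) : ℝ) / q) := by
  have hqr : (0 : ℝ) < q := by exact_mod_cast hq
  have hqz : (0 : ℤ) < q := by exact_mod_cast hq
  obtain ⟨ε, hε, hε34, -, -⟩ := cell_decomposition (a := a) hq hK hjlo hjhi hfk h2k
  rw [hε]
  set n : ℤ := (m : ℤ) * a + f with hn
  set c : ℤ := n % q with hcdef
  -- `n/q = c/q + (n / q : ℤ)`
  have hsplit : ((n : ℤ) : ℝ) / q = ((c : ℤ) : ℝ) / q + (((n / q : ℤ)) : ℝ) := by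
    have := Int.emod_add_ediv_mul n q
    rw [← hcdef] at this
    have h1 : ((n : ℤ) : ℝ) = c + (n / q : ℤ) * (q : ℝ) := by exact_mod_cast this.symm
    rw [h1]; field_simp
  have hdist : distInt (((n : ℤ) : ℝ) / q + ε) = distInt (((c : ℤ) : ℝ) / q + ε) := by
    rw [hsplit, show ((c : ℤ) : ℝ) / q + (((n / q : ℤ)) : ℝ) + ε = ((c : ℤ) : ℝ) / q + ε + (((n / q : ℤ)) : ℝ) by ring,
      distInt_add_int]
  have hG : geomBound V (((n : ℤ) : ℝ) / q + ε) = geomBound V (((c : ℤ) : ℝ) / q + ε) := by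
    unfold geomBound; rw [hdist]
  rw [hG]
  -- `‖c/q‖ ≥ 1/q`
  have hc0 : 0 < c := lt_of_le_of_ne (Int.emod_nonneg _ hqz.ne') (Ne.symm hc)
  have hcq : c < q := Int.emod_lt_of_pos _ hqz
  have hfar : 1 / (q : ℝ) ≤ distInt (((c : ℤ) : ℝ) / q) := by
    unfold distInt
    set r := round (((c : ℤ) : ℝ) / q) with hr
    have hne : c - r * q ≠ 0 := by
      intro h
      have : (q : ℤ) ∣ c := ⟨r, by linarith⟩
      exact absurd (Int.le_of_dvd hc0 this) (not_le.mpr hcq)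
    have h1 : (1 : ℝ) ≤ |(((c - r * q : ℤ)) : ℝ)| := by exact_mod_cast Int.one_le_abs hne
    have heq : ((c : ℤ) : ℝ) / q - r = (((c - r * q : ℤ)) : ℝ) / q := by push_cast; field_simp
    rw [heq, abs_div, abs_of_pos hqr]
    exact div_le_div_of_nonneg_right h1 hqr.le
  have hds : 0 < distInt (((c : ℤ) : ℝ) / q) := lt_of_lt_of_le (by positivity) hfar
  apply geomBound_le_two_div V hds
  calc |ε| ≤ 3 / (4 * (q : ℝ)) := hε34
    _ = 3 / 4 * (1 / q) := by ring
    _ ≤ 3 / 4 * distInt (((c : ℤ) : ℝ) / q) := by gcongr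

/-- **The zero class, `|k| ≥ 2`**: if `q ∣ ma + f` and `|k| ≥ 2` then
`min(x/m, 1/(2‖mt‖)) ≤ qK/|k|`. [cite: Harper2016, §4, p. 17] -/
theorem geomBound_cell_le_of_dvd (hq : 0 < q) (hK : 4 ≤ K)
    (hjlo : (j : ℝ) ≤ (m : ℝ) * q * K * η) (hjhi : (m : ℝ) * q * K * η < j + 1)
    (hfk : (j : ℤ) = K * f + k) (h2k : 2 * |k| ≤ K) (hc : (q : ℤ) ∣ (m : ℤ) * a + f) (hk : 2 ≤ |k|)
    (V : ℝ) :
    geomBound V ((m : ℝ) * ((a : ℝ) / q + η)) ≤ (q : ℝ) * K / |(k : ℝ)| := by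
  have hqr : (0 : ℝ) < q := by exact_mod_cast hq
  have hKr : (4 : ℝ) ≤ K := by exact_mod_cast hK
  have hqK : (0 : ℝ) < q * K := by positivity
  obtain ⟨ε, hε, -, hεlo, hεhi⟩ := cell_decomposition (a := a) hq hK hjlo hjhi hfk h2k
  rw [hε]
  obtain ⟨n, hn⟩ := hc
  have hint : (((((m : ℤ) * a + f : ℤ)) : ℝ)) / q = ((n : ℤ) : ℝ) := by
    rw [hn]; push_cast; field_simp
  have hG : geomBound V ((((((m : ℤ) * a + f : ℤ)) : ℝ)) / q + ε) = geomBound V ε := by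
    unfold geomBound
    rw [hint, show ((n : ℤ) : ℝ) + ε = ε + ((n : ℤ) : ℝ) by ring, distInt_add_int]
  rw [hG]
  have hkr : (2 : ℝ) ≤ |(k : ℝ)| := by
    have : ((2 : ℤ) : ℝ) ≤ ((|k| : ℤ) : ℝ) := by exact_mod_cast hk
    push_cast at this; exact this
  have h2k' : 2 * |(k : ℝ)| ≤ K := by
    have : ((2 * |k| : ℤ) : ℝ) ≤ ((K : ℤ) : ℝ) := by exact_mod_cast h2k
    push_cast at this; exact this
  -- `‖ε‖ ≥ (|k| − 1)/(qK)`
  have hlow : (|(k : ℝ)| - 1) / (q * K) ≤ distInt ε := by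
    refine le_trans ?_ (min_abs_le_distInt ε)
    rw [le_min_iff]
    refine ⟨hεlo, ?_⟩
    -- `1 − |ε| ≥ 1 − (|k|+1)/(qK) ≥ (|k|−1)/(qK)` since `2|k| ≤ qK`
    have hq1 : (1 : ℝ) ≤ q := by exact_mod_cast hq
    have : (|(k : ℝ)| - 1) / (q * K) + (|(k : ℝ)| + 1) / (q * K) ≤ 1 := by
      rw [← add_div, div_le_one hqK]; nlinarith
    linarith
  have hpos : 0 < distInt ε := lt_of_lt_of_le (by apply div_pos (by linarith) hqK) hlow
  calc geomBound V ε ≤ 1 / (2 * distInt ε) := geomBound_le_inv V hpos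
    _ ≤ 1 / (2 * ((|(k : ℝ)| - 1) / (q * K))) := by
        apply one_div_le_one_div_of_le (by apply mul_pos two_pos (div_pos (by linarith) hqK)); linarith
    _ = (q : ℝ) * K / (2 * (|(k : ℝ)| - 1)) := by field_simp
    _ ≤ (q : ℝ) * K / |(k : ℝ)| := by
        apply div_le_div_of_nonneg_left (by positivity) (by positivity); linarith

/-- **The trivial bound** `min(x/m, ·) ≤ x/m ≤ x q K η/j` in the cell `j ≤ mqKη`. [folklore] -/
theorem geomBound_cell_le_trivial (hx : 0 < x) (hm : 0 < m) (hj : 0 < j)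
    (hjlo : (j : ℝ) ≤ (m : ℝ) * q * K * η) (θ : ℝ) :
    geomBound (x / m) θ ≤ x * q * K * η / j := by
  have hmr : (0 : ℝ) < m := by exact_mod_cast hm
  have hjr : (0 : ℝ) < j := by exact_mod_cast hj
  calc geomBound (x / m) θ ≤ x / m := geomBound_le _ _
    _ ≤ x * q * K * η / j := by
        rw [div_le_div_iff₀ hmr hjr]; nlinarith

end Cell

/-! ### The sum over one cell -/

/-- **One cell.** Let `S` be a finite set of positive integers `m` in the cell `j ≤ mqKη < j+1`
(`j ≥ 1`, `j = Kf + k`, `2|k| ≤ K`), `(a, q) = 1`, and suppose each residue class mod `q` meets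
`S` in at most `N` elements. Then
`∑_{m ∈ S} min(x/m, 1/(2‖m(a/q+η)‖)) ≤ N · 4q(1 + log q) + N · B_j`, where `B_j = qK/|k|` if
`|k| ≥ 2` and `B_j = xqKη/j` otherwise. [cite: Harper2016, §4, p. 17, display (4.2)] -/
theorem sum_geomBound_cell_le {x η : ℝ} {q K : ℕ} {a : ℤ} {j f : ℕ} {k : ℤ} (hx : 0 < x)
    (hq : 0 < q) (hK : 4 ≤ K) (hη : 0 < η) (hj : 0 < j) (hcop : IsCoprime a (q : ℤ))
    (hfk : (j : ℤ) = K * f + k) (h2k : 2 * |k| ≤ K) (S : Finset ℕ)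
    (hS : ∀ m ∈ S, 0 < m ∧ (j : ℝ) ≤ (m : ℝ) * q * K * η ∧ (m : ℝ) * q * K * η < j + 1)
    {N : ℝ} (hN0 : 0 ≤ N) (hN : ∀ b : ℕ, b < q → ((S.filter (fun m => m % q = b)).card : ℝ) ≤ N) :
    ∑ m ∈ S, geomBound (x / m) ((m : ℝ) * ((a : ℝ) / q + η)) ≤
      N * (4 * q * (1 + Real.log q)) +
        N * (if 2 ≤ |k| then (q : ℝ) * K / |(k : ℝ)| else x * q * K * η / j) := by
  classical
  have hqz : (0 : ℤ) < q := by exact_mod_cast hq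
  have hqr : (0 : ℝ) < q := by exact_mod_cast hq
  have hK4 : (4 : ℝ) ≤ K := by exact_mod_cast hK
  have hKr : (0 : ℝ) < K := by linarith
  -- the class function
  set cf : ℕ → ℕ := fun m => ((((m : ℤ) * a + f) % q).toNat) with hcf
  have hcfval : ∀ m : ℕ, ((cf m : ℕ) : ℤ) = ((m : ℤ) * a + f) % q := by
    intro m; rw [hcf]; exact Int.toNat_of_nonneg (Int.emod_nonneg _ hqz.ne')
  have hmaps : ∀ m ∈ S, cf m ∈ Finset.range q := by
    intro m _
    rw [Finset.mem_range]
    have : ((cf m : ℕ) : ℤ) < q := by rw [hcfval]; exact Int.emod_lt_of_pos _ hqz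
    exact_mod_cast this
  -- each class fibre has at most `N` elements
  have hfibN : ∀ c : ℕ, ((S.filter (fun m => cf m = c)).card : ℝ) ≤ N := by
    intro c
    rcases (S.filter (fun m => cf m = c)).eq_empty_or_nonempty with h0 | ⟨m₀, hm₀⟩
    · rw [h0, Finset.card_empty]; exact_mod_cast hN0
    · rw [Finset.mem_filter] at hm₀
      have hb₀ : m₀ % q < q := Nat.mod_lt _ hq
      refine le_trans ?_ (hN (m₀ % q) hb₀)
      have hsub : S.filter (fun m => cf m = c) ⊆ S.filter (fun m => m % q = m₀ % q) := by
        intro m hm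
        rw [Finset.mem_filter] at hm ⊢
        refine ⟨hm.1, ?_⟩
        have h1 : ((m : ℤ) * a + f) % q = ((m₀ : ℤ) * a + f) % q := by
          rw [← hcfval, ← hcfval, hm.2, hm₀.2]
        have h2 : (q : ℤ) ∣ ((m : ℤ) - m₀) * a := by
          have := Int.ModEq.dvd h1.symm
          rw [show (m : ℤ) * a + f - ((m₀ : ℤ) * a + f) = ((m : ℤ) - m₀) * a by ring] at this
          exact this
        have h3 : (q : ℤ) ∣ (m : ℤ) - m₀ := hcop.symm.dvd_of_dvd_mul_right h2
        have h4 : (m₀ : ℤ) ≡ m [ZMOD q] := (Int.modEq_iff_dvd.mpr h3)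
        have h5 : m₀ ≡ m [MOD q] := Int.natCast_modEq_iff.mp h4
        exact h5.symm
      exact_mod_cast Finset.card_le_card hsub
  -- pointwise facts for members
  rw [← Finset.sum_fiberwise_of_maps_to hmaps]
  have h0mem : (0 : ℕ) ∈ Finset.range q := Finset.mem_range.mpr hq
  rw [← Finset.add_sum_erase _ _ h0mem, ← Finset.filter_ne']
  rw [add_comm]
  refine add_le_add ?_ ?_
  · ------------------------------------------------------------------
    -- nonzero classes
    have hfib : ∀ c ∈ (Finset.range q).filter (fun c => c ≠ 0),
        ∑ m ∈ S.filter (fun m => cf m = c), geomBound (x / m) ((m : ℝ) * ((a : ℝ) / q + η)) ≤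
          N * (2 / distInt ((c : ℝ) / q)) := by
      intro c hc
      rw [Finset.mem_filter] at hc
      have hpt : ∀ m ∈ S.filter (fun m => cf m = c),
          geomBound (x / m) ((m : ℝ) * ((a : ℝ) / q + η)) ≤ 2 / distInt ((c : ℝ) / q) := by
        intro m hm
        rw [Finset.mem_filter] at hm
        obtain ⟨-, hjlo, hjhi⟩ := hS m hm.1
        have hne : ((m : ℤ) * a + f) % q ≠ 0 := by
          rw [← hcfval, hm.2]; exact_mod_cast hc.2
        have key := geomBound_cell_le_of_ne (a := a) hq hK hjlo hjhi hfk h2k hne (x / m)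
        have hcast : (((((m : ℤ) * a + f) % q : ℤ)) : ℝ) = (c : ℝ) := by
          rw [← hcfval, hm.2]; push_cast; ring
        rw [hcast] at key; exact key
      calc ∑ m ∈ S.filter (fun m => cf m = c), geomBound (x / m) ((m : ℝ) * ((a : ℝ) / q + η))
          ≤ ∑ m ∈ S.filter (fun m => cf m = c), (2 / distInt ((c : ℝ) / q)) := Finset.sum_le_sum hpt
        _ = (S.filter (fun m => cf m = c)).card * (2 / distInt ((c : ℝ) / q)) := by
            rw [Finset.sum_const, nsmul_eq_mul]
        _ ≤ N * (2 / distInt ((c : ℝ) / q)) :=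
            mul_le_mul_of_nonneg_right (hfibN c) (div_nonneg (by norm_num) (distInt_nonneg _))
    calc ∑ c ∈ (Finset.range q).filter (fun c => c ≠ 0),
          ∑ m ∈ S.filter (fun m => cf m = c), geomBound (x / m) ((m : ℝ) * ((a : ℝ) / q + η))
        ≤ ∑ c ∈ (Finset.range q).filter (fun c => c ≠ 0), N * (2 / distInt ((c : ℝ) / q)) :=
          Finset.sum_le_sum hfib
      _ = N * ∑ c ∈ (Finset.range q).filter (fun c => c ≠ 0), 2 / distInt ((c : ℝ) / q) := by
          rw [Finset.mul_sum]
      _ ≤ N * (4 * q * (1 + Real.log q)) := mul_le_mul_of_nonneg_left (sum_two_div_distInt_le hq) hN0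
  · ------------------------------------------------------------------
    -- the zero class
    set B : ℝ := if 2 ≤ |k| then (q : ℝ) * K / |(k : ℝ)| else x * q * K * η / j with hB
    have hpt : ∀ m ∈ S.filter (fun m => cf m = 0),
        geomBound (x / m) ((m : ℝ) * ((a : ℝ) / q + η)) ≤ B := by
      intro m hm
      rw [Finset.mem_filter] at hm
      obtain ⟨hm0, hjlo, hjhi⟩ := hS m hm.1
      have hdvd : (q : ℤ) ∣ (m : ℤ) * a + f := by
        apply Int.dvd_of_emod_eq_zero
        rw [← hcfval, hm.2]; rfl
      rw [hB]
      split_ifs with hk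
      · exact geomBound_cell_le_of_dvd (a := a) hq hK hjlo hjhi hfk h2k hdvd hk (x / m)
      · exact geomBound_cell_le_trivial hx hm0 hj hjlo _
    calc ∑ m ∈ S.filter (fun m => cf m = 0), geomBound (x / m) ((m : ℝ) * ((a : ℝ) / q + η))
        ≤ ∑ m ∈ S.filter (fun m => cf m = 0), B := Finset.sum_le_sum hpt
      _ = (S.filter (fun m => cf m = 0)).card * B := by rw [Finset.sum_const, nsmul_eq_mul]
      _ ≤ N * B := by
          apply mul_le_mul_of_nonneg_right (hfibN 0)
          rw [hB]; split_ifs <;> positivity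

/-! ### Sums over the cells `j` -/

/-- Counting `j ≤ J₁` with a given centred residue: at most `J₁/K + 1` of them. [folklore] -/
theorem card_filter_centred_eq_le {K J₁ : ℕ} (hK : 0 < K) (f : ℕ → ℕ) (k : ℕ → ℤ)
    (hfk : ∀ j : ℕ, (j : ℤ) = K * f j + k j) (Jset : Finset ℕ) (hJ : Jset ⊆ Finset.range (J₁ + 1))
    (v : ℤ) : (Jset.filter (fun j => k j = v)).card ≤ J₁ / K + 1 := by
  classical
  have hinj : Set.InjOn (fun j : ℕ => j / K) (Jset.filter (fun j => k j = v) : Set ℕ) := by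
    intro j₁ hj₁ j₂ hj₂ h
    simp only [Finset.coe_filter, Set.mem_setOf_eq] at hj₁ hj₂
    have e1 := hfk j₁
    have e2 := hfk j₂
    rw [hj₁.2] at e1
    rw [hj₂.2] at e2
    -- `j₁ - j₂ = K (f j₁ - f j₂)` and `|j₁ - j₂| < K`
    have hdiff : (j₁ : ℤ) - j₂ = K * ((f j₁ : ℤ) - f j₂) := by rw [e1, e2]; ring
    have hlt : |(j₁ : ℤ) - j₂| < K := by
      have h1 := Nat.div_add_mod j₁ K
      have h2 := Nat.div_add_mod j₂ K
      have h3 : j₁ / K = j₂ / K := h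
      have hm1 := Nat.mod_lt j₁ hK
      have hm2 := Nat.mod_lt j₂ hK
      rw [h3] at h1
      generalize hQ : K * (j₂ / K) = Q at h1 h2
      rw [abs_lt]; constructor <;> omega
    have hf : (f j₁ : ℤ) = f j₂ := by
      by_contra hne
      have h1 : (1 : ℤ) ≤ |(f j₁ : ℤ) - f j₂| := Int.one_le_abs (sub_ne_zero.mpr hne)
      have h2 : (K : ℤ) ≤ |(j₁ : ℤ) - j₂| := by
        rw [hdiff, abs_mul, Nat.abs_cast]
        nlinarith
      linarith
    have : (j₁ : ℤ) = j₂ := by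
      have : (j₁ : ℤ) - j₂ = 0 := by rw [hdiff, hf, sub_self, mul_zero]
      linarith
    exact_mod_cast this
  calc (Jset.filter (fun j => k j = v)).card
      ≤ (Finset.range (J₁ / K + 1)).card := by
        refine Finset.card_le_card_of_injOn (fun j => j / K) (fun j hj => ?_) hinj
        rw [Finset.mem_coe, Finset.mem_range]
        have hj' : j ∈ Finset.range (J₁ + 1) := hJ (Finset.mem_filter.mp hj).1
        rw [Finset.mem_range] at hj'
        exact Nat.lt_succ_of_le (Nat.div_le_div_right (by omega))
    _ = J₁ / K + 1 := Finset.card_range _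

/-- **The cells with `|k(j)| ≥ 2`**: `∑_{j} c/|k(j)| ≤ 2 (J₁/K + 1) c (1 + log K)`.
[cite: Harper2016, §4, p. 17 (second term of (4.2))] -/
theorem sum_div_abs_centred_le {K J₁ : ℕ} (hK : 4 ≤ K) (f : ℕ → ℕ) (k : ℕ → ℤ)
    (hfk : ∀ j : ℕ, (j : ℤ) = K * f j + k j) (h2k : ∀ j, 2 * |k j| ≤ K) (Jset : Finset ℕ)
    (hJ : Jset ⊆ Finset.range (J₁ + 1)) {c : ℝ} (hc : 0 ≤ c) :
    ∑ j ∈ Jset.filter (fun j => 2 ≤ |k j|), c / |(k j : ℝ)| ≤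
      2 * (((J₁ / K : ℕ) : ℝ) + 1) * c * (1 + Real.log K) := by
  classical
  have hK0 : 0 < K := by omega
  set T := Jset.filter (fun j => 2 ≤ |k j|) with hT
  set g : ℕ → ℕ := fun j => (k j).natAbs with hg
  have hmaps : ∀ j ∈ T, g j ∈ Finset.Icc 1 K := by
    intro j hj
    rw [hT, Finset.mem_filter] at hj
    rw [Finset.mem_Icc, hg]
    have h1 : (2 : ℤ) ≤ |k j| := hj.2
    have h2 := h2k j
    constructor
    · zify; linarith
    · zify; linarith [abs_nonneg (k j)]
  rw [← Finset.sum_fiberwise_of_maps_to hmaps]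
  have hfib : ∀ n ∈ Finset.Icc 1 K, ∑ j ∈ T.filter (fun j => g j = n), c / |(k j : ℝ)| ≤
      (2 * (((J₁ / K : ℕ) : ℝ) + 1)) * (c / n) := by
    intro n hn
    rw [Finset.mem_Icc] at hn
    have hn0 : (0 : ℝ) < n := by exact_mod_cast hn.1
    have hval : ∀ j ∈ T.filter (fun j => g j = n), c / |(k j : ℝ)| = c / n := by
      intro j hj
      rw [Finset.mem_filter] at hj
      have : |(k j : ℝ)| = n := by
        rw [← hj.2]; simp only [hg, Nat.cast_natAbs, Int.cast_abs]
      rw [this]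
    rw [Finset.sum_congr rfl hval, Finset.sum_const, nsmul_eq_mul]
    apply mul_le_mul_of_nonneg_right _ (by positivity)
    -- the fibre is contained in `{k j = n} ∪ {k j = -n}`
    have hsub : T.filter (fun j => g j = n) ⊆
        Jset.filter (fun j => k j = n) ∪ Jset.filter (fun j => k j = -(n : ℤ)) := by
      intro j hj
      rw [Finset.mem_filter] at hj
      have hjJ : j ∈ Jset := (Finset.mem_filter.mp hj.1).1
      rw [Finset.mem_union, Finset.mem_filter, Finset.mem_filter]
      have : (k j).natAbs = n := hj.2
      rcases Int.natAbs_eq (k j) with h | h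
      · left; exact ⟨hjJ, by rw [h, this]⟩
      · right; exact ⟨hjJ, by rw [h, this]⟩
    have h1 := card_filter_centred_eq_le hK0 f k hfk Jset hJ n
    have h2 := card_filter_centred_eq_le hK0 f k hfk Jset hJ (-(n : ℤ))
    have h3 := (Finset.card_le_card hsub).trans (Finset.card_union_le _ _)
    have : ((T.filter (fun j => g j = n)).card : ℝ) ≤ ((J₁ / K + 1 : ℕ) : ℝ) + ((J₁ / K + 1 : ℕ) : ℝ) := by
      exact_mod_cast h3.trans (add_le_add h1 h2)
    push_cast at this
    linarith
  calc ∑ n ∈ Finset.Icc 1 K, ∑ j ∈ T.filter (fun j => g j = n), c / |(k j : ℝ)|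
      ≤ ∑ n ∈ Finset.Icc 1 K, (2 * (((J₁ / K : ℕ) : ℝ) + 1)) * (c / n) := Finset.sum_le_sum hfib
    _ = 2 * (((J₁ / K : ℕ) : ℝ) + 1) * c * ∑ n ∈ Finset.Icc 1 K, (1 : ℝ) / n := by
        rw [Finset.mul_sum]; refine Finset.sum_congr rfl fun n _ => ?_; ring
    _ ≤ 2 * (((J₁ / K : ℕ) : ℝ) + 1) * c * (1 + Real.log K) :=
        mul_le_mul_of_nonneg_left (sum_Icc_one_div_le_one_add_log K) (by positivity)

/-- **The cells with `|k(j)| ≤ 1`** (`j ≥ J₀ ≥ 2`): `∑_j c/j ≤ (6c/K)(1 + log((J₁+1)/K))`.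
[cite: Harper2016, §4, p. 17 (third term of (4.2))] -/
theorem sum_div_trivial_cells_le {K J₀ J₁ : ℕ} (hK : 4 ≤ K) (hJ₀ : 2 ≤ J₀) (f : ℕ → ℕ) (k : ℕ → ℤ)
    (hfk : ∀ j : ℕ, (j : ℤ) = K * f j + k j) (hf1 : ∀ j, |k j| ≤ 1 → f j = (j + 1) / K)
    (Jset : Finset ℕ) (hJ : Jset ⊆ Finset.Icc J₀ J₁) {c : ℝ} (hc : 0 ≤ c) :
    ∑ j ∈ Jset.filter (fun j => |k j| ≤ 1), c / (j : ℝ) ≤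
      6 * c / K * (1 + Real.log (((J₁ + 1) / K : ℕ) : ℝ)) := by
  classical
  have hK0 : 0 < K := by omega
  have hKr : (4 : ℝ) ≤ K := by exact_mod_cast hK
  set T := Jset.filter (fun j => |k j| ≤ 1) with hT
  set I := (J₁ + 1) / K with hI
  have hmem : ∀ j ∈ T, J₀ ≤ j ∧ j ≤ J₁ ∧ |k j| ≤ 1 ∧ f j = (j + 1) / K := by
    intro j hj
    rw [hT, Finset.mem_filter] at hj
    have := hJ hj.1
    rw [Finset.mem_Icc] at this
    exact ⟨this.1, this.2, hj.2, hf1 j hj.2⟩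
  have hmaps : ∀ j ∈ T, f j ∈ Finset.Icc 1 I := by
    intro j hj
    obtain ⟨hj0, hj1, hk1, hfj⟩ := hmem j hj
    rw [Finset.mem_Icc, hfj, hI]
    constructor
    · -- `f j ≥ 1`: else `j = k j ≤ 1`
      by_contra h0
      push Not at h0
      have h0' : (j + 1) / K = 0 := by omega
      have e := hfk j
      rw [hfj, h0'] at e
      simp only [Nat.cast_zero, mul_zero, zero_add] at e
      have : (j : ℤ) ≤ 1 := by rw [e]; exact le_trans (le_abs_self _) hk1
      omega
    · exact Nat.div_le_div_right (by omega)
  rw [← Finset.sum_fiberwise_of_maps_to hmaps]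
  have hfib : ∀ i ∈ Finset.Icc 1 I, ∑ j ∈ T.filter (fun j => f j = i), c / (j : ℝ) ≤ 3 * (2 * c / (K * i)) := by
    intro i hi
    rw [Finset.mem_Icc] at hi
    have hi0 : (1 : ℝ) ≤ i := by exact_mod_cast hi.1
    have hKi : (2 : ℝ) ≤ (K : ℝ) * i - 1 := by nlinarith
    have hpt : ∀ j ∈ T.filter (fun j => f j = i), c / (j : ℝ) ≤ 2 * c / (K * i) := by
      intro j hj
      rw [Finset.mem_filter] at hj
      obtain ⟨-, -, hk1, -⟩ := hmem j hj.1
      have e := hfk j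
      rw [hj.2] at e
      have hjge : (K : ℝ) * i - 1 ≤ j := by
        have h1 : (K : ℤ) * i - 1 ≤ j := by
          rw [e]; linarith [neg_abs_le (k j)]
        exact_mod_cast h1
      have hj0 : (0 : ℝ) < j := by linarith
      rw [div_le_div_iff₀ hj0 (by positivity)]
      nlinarith
    have hcard : (T.filter (fun j => f j = i)).card ≤ 3 := by
      have hsub : T.filter (fun j => f j = i) ⊆ Finset.Icc (K * i - 1) (K * i + 1) := by
        intro j hj
        rw [Finset.mem_filter] at hj
        obtain ⟨-, -, hk1, -⟩ := hmem j hj.1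
        have e := hfk j
        rw [hj.2] at e
        rw [Finset.mem_Icc]
        have h1 := neg_abs_le (k j)
        have h2 := le_abs_self (k j)
        constructor <;> omega
      refine (Finset.card_le_card hsub).trans ?_
      rw [Nat.card_Icc]; omega
    calc ∑ j ∈ T.filter (fun j => f j = i), c / (j : ℝ)
        ≤ ∑ j ∈ T.filter (fun j => f j = i), 2 * c / (K * i) := Finset.sum_le_sum hpt
      _ = (T.filter (fun j => f j = i)).card * (2 * c / (K * i)) := by rw [Finset.sum_const, nsmul_eq_mul]
      _ ≤ 3 * (2 * c / (K * i)) := by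
          apply mul_le_mul_of_nonneg_right _ (by positivity)
          exact_mod_cast hcard
  calc ∑ i ∈ Finset.Icc 1 I, ∑ j ∈ T.filter (fun j => f j = i), c / (j : ℝ)
      ≤ ∑ i ∈ Finset.Icc 1 I, 3 * (2 * c / (K * i)) := Finset.sum_le_sum hfib
    _ = 6 * c / K * ∑ i ∈ Finset.Icc 1 I, (1 : ℝ) / i := by
        rw [Finset.mul_sum]; refine Finset.sum_congr rfl fun i hi => ?_
        rw [Finset.mem_Icc] at hi
        have : (0 : ℝ) < i := by exact_mod_cast hi.1
        field_simp; ring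
    _ ≤ 6 * c / K * (1 + Real.log I) :=
        mul_le_mul_of_nonneg_left (sum_Icc_one_div_le_one_add_log I) (by positivity)

/-! ### The hard range -/

set_option maxHeartbeats 6000000 in
-- a long assembly
/-- **Fairly major differences, the hard range** (Harper, first half of the proof of
Proposition 4). See the module docstring. [cite: Harper2016, §4, Proposition 4 (p. 17)] -/
theorem sum_geomBound_prefix_hard_le :
    ∃ C x₀ : ℝ, 0 < C ∧ ∀ (x : ℝ) (y : ℕ), x₀ ≤ x → Real.log x ^ 4 ≤ y →
      Real.log y ≤ Real.log x ^ (1 / 6 : ℝ) → ∀ (K : ℕ), 16 ≤ K →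
      ∀ (q : ℕ), 1 ≤ q → ∀ (a : ℤ), IsCoprime a (q : ℤ) → ∀ (η : ℝ), 0 < η →
      η * (q : ℝ) ^ 2 * K * y ≤ 1 →
        ∑ m ∈ (prefixSet y (x / (y * K))).filter (fun m : ℕ => 1 / 2 < (m : ℝ) * η * q),
            geomBound (x / m) ((m : ℝ) * ((a : ℝ) / q + η)) ≤
          C * Real.log y *
            (1 + Real.log q + Real.log K + Real.log ((q : ℝ) ^ 2 * K * η * x + 1)) *
            (y : ℝ) ^ (1 - saddlePoint x y) * ((q : ℝ) ^ 2 * K * η * x) ^ (1 - saddlePoint x y) *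
            (x ^ saddlePoint x y *
              (smoothZeta (saddlePoint x y) y / Real.sqrt (saddlePhi₂ (saddlePoint x y) y))) / K := by
  classical
  obtain ⟨C₃, x₀₃, hC₃, hS3⟩ := card_smooth_segment_modEq_le
  obtain ⟨x₀1, hlt1⟩ := saddlePoint_lt_one
  refine ⟨40 * C₃, max (max x₀₃ x₀1) (Real.exp 4), by positivity,
    fun x y hx hy4 hy6 K hK16 q hq1 a hcop η hη hηq => ?_⟩
  have hx₀₃ : x₀₃ ≤ x := le_trans ((le_max_left _ _).trans (le_max_left _ _)) hx
  have hx₀1 : x₀1 ≤ x := le_trans ((le_max_right _ _).trans (le_max_left _ _)) hx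
  have hxe : Real.exp 4 ≤ x := le_trans (le_max_right _ _) hx
  ------------------------------------------------------------------
  -- ### the range
  set Lx := Real.log x with hLx
  have hLx4 : 4 ≤ Lx := by
    have := Real.log_le_log (Real.exp_pos _) hxe; rwa [Real.log_exp] at this
  have hx1 : 1 < x := by
    have : (1 : ℝ) < Real.exp 4 := by have := Real.add_one_le_exp (4 : ℝ); linarith
    exact lt_of_lt_of_le this hxe
  have hx0 : 0 < x := by linarith
  have hLx1 : 1 ≤ Lx := by linarith
  have hy256 : (256 : ℝ) ≤ y := by
    have : (4 : ℝ) ^ 4 ≤ Lx ^ 4 := pow_le_pow_left₀ (by norm_num) hLx4 4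
    norm_num at this; linarith
  have hy1 : (1 : ℝ) ≤ y := by linarith
  have hy0 : (0 : ℝ) < y := by linarith
  have hy2 : 2 ≤ y := by exact_mod_cast (show (2 : ℝ) ≤ y by linarith)
  have hlogy0 : 0 ≤ Real.log y := Real.log_nonneg hy1
  have hlogy : Real.log y ≤ Lx := by
    refine hy6.trans ?_
    calc Real.log x ^ (1 / 6 : ℝ) ≤ Real.log x ^ (1 : ℝ) := Real.rpow_le_rpow_of_exponent_le hLx1 (by norm_num)
      _ = Lx := by rw [Real.rpow_one]
  have hyx : (y : ℝ) ≤ x := by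
    rw [← Real.exp_log hy0, ← Real.exp_log hx0]; exact Real.exp_le_exp.mpr hlogy
  have hK16r : (16 : ℝ) ≤ K := by exact_mod_cast hK16
  have hK0 : (0 : ℝ) < K := by linarith
  have hK4 : 4 ≤ K := by omega
  have hK3 : 3 ≤ K := by omega
  have hKpos : 0 < K := by omega
  have hq0 : (0 : ℝ) < q := by exact_mod_cast hq1
  have hq1r : (1 : ℝ) ≤ q := by exact_mod_cast hq1
  have hq : 0 < q := hq1
  set α := saddlePoint x y with hαdef
  have hα0 : 0 < α := by rw [hαdef]; exact saddlePoint_pos hx1 hy2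
  have hα1 : α ≤ 1 := by
    have hy3 : Real.log x ^ 3 ≤ y := by
      calc Real.log x ^ 3 ≤ Real.log x ^ 4 := pow_le_pow_right₀ hLx1 (by norm_num)
        _ ≤ y := hy4
    exact (hlt1 x y hx₀1 hy3 hyx hy6).le
  set ζt := smoothZeta α y / Real.sqrt (saddlePhi₂ α y) with hζt
  have hζt0 : 0 ≤ ζt := div_nonneg (smoothZeta_pos hα0).le (Real.sqrt_nonneg _)
  set 𝓟 := x ^ α * ζt with h𝓟
  have h𝓟0 : 0 ≤ 𝓟 := by positivity
  set P₀ : ℝ := (q : ℝ) ^ 2 * K * η * x with hP₀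
  have hP₀0 : 0 < P₀ := by positivity
  have hlogq0 : 0 ≤ Real.log q := Real.log_nonneg hq1r
  have hlogK0 : 0 ≤ Real.log K := Real.log_nonneg (by linarith)
  have hlogP0 : 0 ≤ Real.log (P₀ + 1) := Real.log_nonneg (by linarith)
  -- the right-hand side is nonnegative
  set RHS : ℝ := 40 * C₃ * Real.log y * (1 + Real.log q + Real.log K + Real.log (P₀ + 1)) *
    (y : ℝ) ^ (1 - α) * P₀ ^ (1 - α) * 𝓟 / K with hRHS
  have hRHS0 : 0 ≤ RHS := by positivity
  ------------------------------------------------------------------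
  -- ### `W`, the set `H`
  set W := x / (y * K) with hW
  have hyK0 : (0 : ℝ) < y * K := by positivity
  have hW0 : 0 < W := by positivity
  have hWy : W * y = x / K := by rw [hW]; field_simp
  set H := (prefixSet y W).filter (fun m : ℕ => 1 / 2 < (m : ℝ) * η * q) with hH
  have hHmem : ∀ m ∈ H, W < m ∧ (m : ℝ) ≤ x / K ∧ m ∈ Nat.smoothNumbers (y + 1) ∧
      1 / 2 < (m : ℝ) * η * q := by
    intro m hm
    rw [hH, Finset.mem_filter, mem_prefixSet hW0.le] at hm
    exact ⟨hm.1.1, hWy ▸ hm.1.2.1, hm.1.2.2.1, hm.2⟩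
  show ∑ m ∈ H, geomBound (x / m) ((m : ℝ) * ((a : ℝ) / q + η)) ≤ RHS
  rcases H.eq_empty_or_nonempty with hH0 | ⟨m₁, hm₁⟩
  · rw [hH0, Finset.sum_empty]; exact hRHS0
  -- `qxη > K/2`
  have hbig : (K : ℝ) / 2 < q * x * η := by
    obtain ⟨-, hm₁x, -, hm₁η⟩ := hHmem m₁ hm₁
    have h1 : (m₁ : ℝ) * η * q ≤ x / K * η * q := by gcongr
    have h2 : 1 / 2 < x / K * η * q := lt_of_lt_of_le hm₁η h1
    rw [div_mul_eq_mul_div, div_mul_eq_mul_div, lt_div_iff₀ hK0] at h2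
    linarith
  have hqxη8 : (8 : ℝ) < q * x * η := by linarith
  ------------------------------------------------------------------
  -- ### the cells
  set ℓ : ℝ := 1 / ((q : ℝ) * K * η) with hℓ
  have hqKη : (0 : ℝ) < q * K * η := by positivity
  have hℓqy : (q : ℝ) * y ≤ ℓ := by
    rw [hℓ, le_div_iff₀ hqKη]; nlinarith
  have hℓ1 : 1 ≤ ℓ := le_trans (by nlinarith) hℓqy
  have hℓ0 : 0 < ℓ := by linarith
  set jf : ℕ → ℕ := fun m => ⌊(m : ℝ) * q * K * η⌋₊ with hjf
  set J₀ : ℕ := K / 2 with hJ₀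
  set J₁ : ℕ := ⌊x / K * q * K * η⌋₊ with hJ₁
  have hJ₀8 : 8 ≤ J₀ := by rw [hJ₀]; omega
  have hJ₀r : ((J₀ : ℕ) : ℝ) ≤ (K : ℝ) / 2 := by rw [hJ₀]; exact Nat.cast_div_le
  have hJ₁r : ((J₁ : ℕ) : ℝ) ≤ q * x * η := by
    rw [hJ₁]
    refine (Nat.floor_le (by positivity)).trans_eq ?_
    field_simp
  have hmapsJ : ∀ m ∈ H, jf m ∈ Finset.Icc J₀ J₁ := by
    intro m hm
    obtain ⟨hWm, hmx, -, hmη⟩ := hHmem m hm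
    rw [Finset.mem_Icc, hjf]
    constructor
    · apply Nat.le_floor
      refine hJ₀r.trans ?_
      have : (K : ℝ) / 2 = 1 / 2 * K := by ring
      rw [this]
      have h1 : 1 / 2 * (K : ℝ) ≤ ((m : ℝ) * η * q) * K := by
        apply mul_le_mul_of_nonneg_right hmη.le hK0.le
      calc 1 / 2 * (K : ℝ) ≤ ((m : ℝ) * η * q) * K := h1
        _ = (m : ℝ) * q * K * η := by ring
    · rw [hJ₁]; apply Nat.floor_mono; gcongr
  choose f k hfk h2k hf1 using fun j => exists_centred_residue hK3 j
  -- the cell count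
  set Ncell : ℝ := C₃ * Real.log y * (2 * ℓ / q) ^ α * (y : ℝ) ^ (1 - α) * ζt with hNcell
  have hNcell0 : 0 ≤ Ncell := by positivity
  have hcellN : ∀ j ∈ Finset.Icc J₀ J₁, ∀ b : ℕ, b < q →
      (((H.filter (fun m => jf m = j)).filter (fun m => m % q = b)).card : ℝ) ≤ Ncell := by
    intro j hj b hb
    rw [Finset.mem_Icc] at hj
    have hj8 : (8 : ℝ) ≤ j := by exact_mod_cast hJ₀8.trans hj.1
    set V : ℝ := (j : ℝ) * ℓ - 1 with hV
    set Z : ℝ := ℓ + 1 with hZ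
    have hV0 : 0 ≤ V := by rw [hV]; nlinarith
    have hZq : (q : ℝ) * y ≤ Z := by rw [hZ]; linarith
    have hVZ : V + Z = ((j : ℝ) + 1) * ℓ := by rw [hV, hZ]; ring
    have hVZx : V + Z ≤ x := by
      rw [hVZ, hℓ, mul_one_div, div_le_iff₀ hqKη]
      -- `j + 1 ≤ qxη + 1 ≤ x q K η`
      have hj1 : (j : ℝ) ≤ q * x * η := le_trans (by exact_mod_cast hj.2) hJ₁r
      nlinarith
    have h1 := hS3 x y hx₀₃ hy4 hy6 q hq b V Z hV0 hZq hVZx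
    rw [← hαdef] at h1
    have hsub : (H.filter (fun m => jf m = j)).filter (fun m => m % q = b) ⊆
        (Finset.Ioc ⌊V⌋₊ ⌊V + Z⌋₊).filter (fun n => n ≡ b [MOD q] ∧ n ∈ Nat.smoothNumbers (y + 1)) := by
      intro m hm
      rw [Finset.mem_filter, Finset.mem_filter] at hm
      obtain ⟨⟨hmH, hmj⟩, hmb⟩ := hm
      obtain ⟨hWm, -, hsm, -⟩ := hHmem m hmH
      have hm0 : (0 : ℝ) ≤ (m : ℝ) * q * K * η := by positivity
      have hjlo : (j : ℝ) ≤ (m : ℝ) * q * K * η := by rw [← hmj, hjf]; exact Nat.floor_le hm0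
      have hjhi : (m : ℝ) * q * K * η < j + 1 := by rw [← hmj, hjf]; exact Nat.lt_floor_add_one _
      rw [Finset.mem_filter, Finset.mem_Ioc]
      refine ⟨⟨?_, ?_⟩, ?_, hsm⟩
      · rw [Nat.floor_lt hV0]
        have : (j : ℝ) * ℓ ≤ m := by
          rw [hℓ, mul_one_div, div_le_iff₀ hqKη]; linarith
        rw [hV]; linarith
      · apply Nat.le_floor
        rw [hVZ, hℓ, mul_one_div, le_div_iff₀ hqKη]; linarith
      · rw [Nat.ModEq, hmb, Nat.mod_eq_of_lt hb]
    calc (((H.filter (fun m => jf m = j)).filter (fun m => m % q = b)).card : ℝ)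
        ≤ ((Finset.Ioc ⌊V⌋₊ ⌊V + Z⌋₊).filter
            (fun n => n ≡ b [MOD q] ∧ n ∈ Nat.smoothNumbers (y + 1))).card := by
          exact_mod_cast Finset.card_le_card hsub
      _ ≤ C₃ * Real.log y * (Z / q) ^ α * (y : ℝ) ^ (1 - α) * (smoothZeta α y / Real.sqrt (saddlePhi₂ α y)) := h1
      _ ≤ Ncell := by
          rw [hNcell, ← hζt]
          have : (Z / q) ^ α ≤ (2 * ℓ / q) ^ α := by
            apply Real.rpow_le_rpow (by positivity) _ hα0.le
            apply div_le_div_of_nonneg_right _ hq0.le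
            rw [hZ]; linarith
          gcongr
  -- per cell
  have hcell : ∀ j ∈ Finset.Icc J₀ J₁,
      ∑ m ∈ H.filter (fun m => jf m = j), geomBound (x / m) ((m : ℝ) * ((a : ℝ) / q + η)) ≤
        Ncell * (4 * q * (1 + Real.log q)) +
          Ncell * (if 2 ≤ |k j| then (q : ℝ) * K / |(k j : ℝ)| else x * q * K * η / j) := by
    intro j hj
    have hj' := hj
    rw [Finset.mem_Icc] at hj'
    have hjpos : 0 < j := by omega
    refine sum_geomBound_cell_le hx0 hq hK4 hη hjpos hcop (hfk j) (h2k j) _ (fun m hm => ?_) hNcell0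
      (fun b hb => hcellN j hj b hb)
    rw [Finset.mem_filter] at hm
    obtain ⟨hWm, -, -, -⟩ := hHmem m hm.1
    have hm0r : (0 : ℝ) < m := lt_trans hW0 hWm
    have hm0 : 0 < m := by exact_mod_cast hm0r
    have hmn : (0 : ℝ) ≤ (m : ℝ) * q * K * η := by positivity
    refine ⟨hm0, ?_, ?_⟩
    · rw [← hm.2, hjf]; exact Nat.floor_le hmn
    · rw [← hm.2, hjf]; exact Nat.lt_floor_add_one _
  ------------------------------------------------------------------
  -- ### summing over the cells
  rw [← Finset.sum_fiberwise_of_maps_to hmapsJ]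
  have hsum1 : ∑ j ∈ Finset.Icc J₀ J₁,
      ∑ m ∈ H.filter (fun m => jf m = j), geomBound (x / m) ((m : ℝ) * ((a : ℝ) / q + η)) ≤
      ((Finset.Icc J₀ J₁).card : ℝ) * (Ncell * (4 * q * (1 + Real.log q))) +
        Ncell * ∑ j ∈ Finset.Icc J₀ J₁,
          (if 2 ≤ |k j| then (q : ℝ) * K / |(k j : ℝ)| else x * q * K * η / j) := by
    calc ∑ j ∈ Finset.Icc J₀ J₁,
          ∑ m ∈ H.filter (fun m => jf m = j), geomBound (x / m) ((m : ℝ) * ((a : ℝ) / q + η))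
        ≤ ∑ j ∈ Finset.Icc J₀ J₁, (Ncell * (4 * q * (1 + Real.log q)) +
            Ncell * (if 2 ≤ |k j| then (q : ℝ) * K / |(k j : ℝ)| else x * q * K * η / j)) :=
          Finset.sum_le_sum hcell
      _ = _ := by rw [Finset.sum_add_distrib, Finset.sum_const, nsmul_eq_mul, Finset.mul_sum]
  -- the `ite` sum
  have hite : ∑ j ∈ Finset.Icc J₀ J₁,
      (if 2 ≤ |k j| then (q : ℝ) * K / |(k j : ℝ)| else x * q * K * η / j) =
      ∑ j ∈ (Finset.Icc J₀ J₁).filter (fun j => 2 ≤ |k j|), (q : ℝ) * K / |(k j : ℝ)| +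
        ∑ j ∈ (Finset.Icc J₀ J₁).filter (fun j => |k j| ≤ 1), x * q * K * η / j := by
    rw [Finset.sum_ite]
    congr 1
    apply Finset.sum_congr _ (fun _ _ => rfl)
    apply Finset.filter_congr
    intro j _
    constructor
    · intro h; linarith [Int.lt_iff_add_one_le.mp (not_le.mp h)]
    · intro h h2; linarith
  have hTB := sum_div_abs_centred_le (J₁ := J₁) hK4 f k hfk h2k (Finset.Icc J₀ J₁)
    (fun j hj => by
      rw [Finset.mem_Icc] at hj; rw [Finset.mem_range]; omega)
    (show (0 : ℝ) ≤ (q : ℝ) * K by positivity)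
  have hTC := sum_div_trivial_cells_le (J₀ := J₀) (J₁ := J₁) hK4 (by omega) f k hfk hf1
    (Finset.Icc J₀ J₁) (subset_refl _) (show (0 : ℝ) ≤ x * q * K * η by positivity)
  ------------------------------------------------------------------
  -- ### numerics
  have hP₀K : (q : ℝ) * (q * x * η) = P₀ / K := by rw [hP₀]; field_simp
  have hqxηP : (q : ℝ) * x * η ≤ P₀ := by
    rw [hP₀]
    have : (1 : ℝ) ≤ q * K := by nlinarith
    nlinarith
  -- #cells
  have hcard : ((Finset.Icc J₀ J₁).card : ℝ) ≤ 2 * (q * x * η) := by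
    have h1 : ((Finset.Icc J₀ J₁).card : ℝ) ≤ J₁ + 1 := by
      have : (Finset.Icc J₀ J₁).card ≤ J₁ + 1 := by rw [Nat.card_Icc]; omega
      exact_mod_cast this
    linarith
  have hA : ((Finset.Icc J₀ J₁).card : ℝ) * (Ncell * (4 * q * (1 + Real.log q))) ≤
      Ncell * (P₀ / K) * (8 * (1 + Real.log q)) := by
    calc ((Finset.Icc J₀ J₁).card : ℝ) * (Ncell * (4 * q * (1 + Real.log q)))
        ≤ (2 * (q * x * η)) * (Ncell * (4 * q * (1 + Real.log q))) :=
          mul_le_mul_of_nonneg_right hcard (by positivity)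
      _ = Ncell * ((q : ℝ) * (q * x * η)) * (8 * (1 + Real.log q)) := by ring
      _ = Ncell * (P₀ / K) * (8 * (1 + Real.log q)) := by rw [hP₀K]
  have hB : ∑ j ∈ (Finset.Icc J₀ J₁).filter (fun j => 2 ≤ |k j|), (q : ℝ) * K / |(k j : ℝ)| ≤
      (P₀ / K) * (6 * (1 + Real.log K)) := by
    refine hTB.trans ?_
    have h1 : (((J₁ / K : ℕ)) : ℝ) ≤ q * x * η / K := by
      calc (((J₁ / K : ℕ)) : ℝ) ≤ (J₁ : ℝ) / K := Nat.cast_div_le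
        _ ≤ q * x * η / K := by gcongr
    have h2 : 2 * ((((J₁ / K : ℕ)) : ℝ) + 1) * ((q : ℝ) * K) ≤ 6 * (P₀ / K) := by
      have h3 : 2 * ((((J₁ / K : ℕ)) : ℝ) + 1) * ((q : ℝ) * K) ≤ 2 * (q * x * η / K + 1) * ((q : ℝ) * K) := by
        gcongr
      have h4 : 2 * (q * x * η / K + 1) * ((q : ℝ) * K) = 2 * ((q : ℝ) * (q * x * η)) + 2 * q * K := by
        field_simp
      have h5 : (q : ℝ) * K ≤ 2 * ((q : ℝ) * (q * x * η)) := by nlinarith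
      rw [hP₀K] at h4 h5
      linarith
    calc 2 * ((((J₁ / K : ℕ)) : ℝ) + 1) * ((q : ℝ) * K) * (1 + Real.log K)
        ≤ 6 * (P₀ / K) * (1 + Real.log K) := mul_le_mul_of_nonneg_right h2 (by linarith)
      _ = (P₀ / K) * (6 * (1 + Real.log K)) := by ring
  have hC : ∑ j ∈ (Finset.Icc J₀ J₁).filter (fun j => |k j| ≤ 1), x * q * K * η / j ≤
      (P₀ / K) * (6 * (1 + Real.log (P₀ + 1))) := by
    refine hTC.trans ?_
    have h1 : 6 * (x * q * K * η) / K = 6 * (q * x * η) := by field_simp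
    have h2 : Real.log ((((J₁ + 1) / K : ℕ)) : ℝ) ≤ Real.log (P₀ + 1) := by
      rcases Nat.eq_zero_or_pos ((J₁ + 1) / K) with h0 | hpos
      · rw [h0, Nat.cast_zero, Real.log_zero]; exact hlogP0
      · apply Real.log_le_log (by exact_mod_cast hpos)
        calc ((((J₁ + 1) / K : ℕ)) : ℝ) ≤ ((J₁ + 1 : ℕ) : ℝ) := by
              exact_mod_cast Nat.div_le_self _ _
          _ = J₁ + 1 := by push_cast; ring
          _ ≤ q * x * η + 1 := by linarith
          _ ≤ P₀ + 1 := by linarith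
    have h3 : (q : ℝ) * x * η ≤ P₀ / K := by
      rw [← hP₀K]; nlinarith
    rw [h1]
    calc 6 * ((q : ℝ) * x * η) * (1 + Real.log ((((J₁ + 1) / K : ℕ)) : ℝ))
        ≤ 6 * (P₀ / K) * (1 + Real.log (P₀ + 1)) := by
          apply mul_le_mul (by linarith) (by linarith) _ (by positivity)
          rcases Nat.eq_zero_or_pos ((J₁ + 1) / K) with h0 | hpos
          · rw [h0, Nat.cast_zero, Real.log_zero]; norm_num
          · have := Real.log_nonneg (show (1 : ℝ) ≤ ((((J₁ + 1) / K : ℕ)) : ℝ) by exact_mod_cast hpos)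
            linarith
      _ = (P₀ / K) * (6 * (1 + Real.log (P₀ + 1))) := by ring
  -- `Ncell · P₀ ≤ 2 C₃ log y P₀^{1-α} y^{1-α} 𝓟`
  have hNP : Ncell * P₀ ≤ 2 * C₃ * Real.log y * (y : ℝ) ^ (1 - α) * P₀ ^ (1 - α) * 𝓟 := by
    have hℓq : 2 * ℓ / q = 2 * (x / P₀) := by rw [hℓ, hP₀]; field_simp
    have h1 : (2 * ℓ / q) ^ α ≤ 2 * (x ^ α * P₀ ^ (-α)) := by
      rw [hℓq, Real.mul_rpow (by norm_num) (by positivity), Real.div_rpow hx0.le hP₀0.le,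
        Real.rpow_neg hP₀0.le, div_eq_mul_inv]
      apply mul_le_mul_of_nonneg_right _ (by positivity)
      calc (2 : ℝ) ^ α ≤ 2 ^ (1 : ℝ) := Real.rpow_le_rpow_of_exponent_le (by norm_num) hα1
        _ = 2 := Real.rpow_one 2
    have h2 : P₀ ^ (-α) * P₀ = P₀ ^ (1 - α) := by
      rw [show (1 : ℝ) - α = -α + 1 by ring, Real.rpow_add hP₀0, Real.rpow_one]
    calc Ncell * P₀ = C₃ * Real.log y * ((2 * ℓ / q) ^ α) * (y : ℝ) ^ (1 - α) * ζt * P₀ := by rw [hNcell]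
      _ ≤ C₃ * Real.log y * (2 * (x ^ α * P₀ ^ (-α))) * (y : ℝ) ^ (1 - α) * ζt * P₀ := by gcongr
      _ = 2 * C₃ * Real.log y * (y : ℝ) ^ (1 - α) * (P₀ ^ (-α) * P₀) * (x ^ α * ζt) := by ring
      _ = _ := by rw [h2, h𝓟]
  ------------------------------------------------------------------
  -- ### combine
  have hlogs : 8 * (1 + Real.log q) + 6 * (1 + Real.log K) + 6 * (1 + Real.log (P₀ + 1)) ≤
      20 * (1 + Real.log q + Real.log K + Real.log (P₀ + 1)) := by nlinarith
  calc ∑ j ∈ Finset.Icc J₀ J₁,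
        ∑ m ∈ H.filter (fun m => jf m = j), geomBound (x / m) ((m : ℝ) * ((a : ℝ) / q + η))
      ≤ ((Finset.Icc J₀ J₁).card : ℝ) * (Ncell * (4 * q * (1 + Real.log q))) +
          Ncell * ∑ j ∈ Finset.Icc J₀ J₁,
            (if 2 ≤ |k j| then (q : ℝ) * K / |(k j : ℝ)| else x * q * K * η / j) := hsum1
    _ ≤ Ncell * (P₀ / K) * (8 * (1 + Real.log q)) +
          Ncell * ((P₀ / K) * (6 * (1 + Real.log K)) + (P₀ / K) * (6 * (1 + Real.log (P₀ + 1)))) := by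
        rw [hite]
        exact add_le_add hA (mul_le_mul_of_nonneg_left (add_le_add hB hC) hNcell0)
    _ = (Ncell * P₀) * (8 * (1 + Real.log q) + 6 * (1 + Real.log K) + 6 * (1 + Real.log (P₀ + 1))) / K := by
        field_simp; ring
    _ ≤ (2 * C₃ * Real.log y * (y : ℝ) ^ (1 - α) * P₀ ^ (1 - α) * 𝓟) *
          (20 * (1 + Real.log q + Real.log K + Real.log (P₀ + 1))) / K := by
        apply div_le_div_of_nonneg_right _ hK0.le
        apply mul_le_mul hNP hlogs (by positivity) (by positivity)
    _ = RHS := by rw [hRHS]; ring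

end Literature.NumberTheory.Sieve

end
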